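import Mathlib
import Summits.NavierStokesRegularity.NavierStokesRegularity.Theorems.RootDecompLitSliceEnergyClockLerayFloor
import HarnessLib

/-!
# Route RootDecompLitSlice — the LERAY-SHARP REDIRECT of the cell Uᶜ `CritTameScarIsCritical`
  (stmt-NavierStokesRegularity-31733): Uᶜ ⟸ «the critical clock is Leray-sharp»

Helper (kernel glue, no item): by `EnergyClockScarLaw.critTameScarIsCritical_iff_roughCell` the cell Uᶜ
is its energy-rough sub-cell, and by `no_energyLaw_above_half` the energy exponent at a first blow-up
is capped at `1/2`. Hence the PURELY TEMPORAL statement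

  CL «at a first blow-up time `T` (maximal smooth solution, Leray–Hopf on `[0,T]`, rapidly decaying
  datum), the critical clock `∫|u(t)−u(T)|² ≤ K√(T−t)` forces LERAY-SHARP dissipation
  `‖u(t)‖₂² − ‖u(T)‖₂² ≤ C√(T−t)` near `T`» (equivalently `∫_t^T‖∇u‖₂² ≍ √(T−t)`, «H¹-mean Type I
  on the critical clock»; no space variable, no scar)

implies Uᶜ: `critTameScarIsCritical_of_leraySharpClock`. CL makes the rough sub-cell vacuous; the
½-Hölder sub-cell is the theorem `halfHolderClockCell`. CL is Tao-vacuous like Uᶜ (abrupt blow-ups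
are outside its hypothesis) and holds vacuously under NS regularity; it is NOT filed as an item here
(a typed attack face recorded for the cell's planner; booking is the critic's ruling).

HONEST FRAMING: helper inside the Tao-vacuous cell Uᶜ; no item, no node, no load of the route moves
(ROOT ⟺ U ∧ P1, critic rows 354/371/563). Rung 0: nothing here proves NS regularity.
Decomp-ns route-writer g36. [folklore]
-/

set_option linter.dupNamespace false

namespace Summit.NavierStokesRegularity.NavierStokesRegularity.Theorems

open MeasureTheory Set
open scoped ENNReal

namespace EnergyClockScarLaw

/-- **Leray-sharp redirect of Uᶜ**: if at every first blow-up the critical clock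
`∫|u(t)−u(T)|² ≤ K√(T−t)` forces the Leray-sharp energy law `‖u(t)‖₂² − ‖u(T)‖₂² ≤ C√(T−t)` near `T`
(statement CL, inlined as the hypothesis), then the cell Uᶜ `CritTameScarIsCritical` holds — by the
½-Hölder sub-cell theorem `halfHolderClockCell`. [folklore] -/
theorem critTameScarIsCritical_of_leraySharpClock
    (hCL : ∀ (ν T : ℝ), 0 < ν → 0 < T →
      ∀ (u : ℝ → EuclideanSpace ℝ (Fin 3) → EuclideanSpace ℝ (Fin 3))
        (p : ℝ → EuclideanSpace ℝ (Fin 3) → ℝ),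
        Literature.Analysis.FluidPDE.IsMaximalSmoothSolution ν 0 u p T →
        Literature.Analysis.FluidPDE.IsLerayHopfOn T ν 0 (u 0) u →
        Literature.Analysis.FluidPDE.HasRapidSpatialDecay (u 0) →
        (∃ K T₁ : ℝ, T₁ < T ∧ ∀ t ∈ Set.Ioo T₁ T,
          ∫⁻ x, ‖u t x - u T x‖ₑ ^ 2 ≤ ENNReal.ofReal (K * Real.sqrt (T - t))) →
        ∃ C T₂ : ℝ, T₂ < T ∧ ∀ t ∈ Set.Ioo T₂ T,
          (∫ x, ‖u t x‖ ^ 2) - ∫ x, ‖u T x‖ ^ 2 ≤ C * Real.sqrt (T - t)) :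
    Summit.NavierStokesRegularity.NavierStokesRegularity.Theses.RootDecompLitSlice.CritTameScarIsCritical := by
  intro ν T hν hT u p hmax hLH hdec htame hclock x₀
  exact halfHolderClockCell ν T hν hT u p hmax hLH hdec htame hclock
    (hCL ν T hν hT u p hmax hLH hdec hclock) x₀

/-- **The redirect is an equivalence of faces modulo the rough cell**: conversely, Uᶜ's conclusion
says nothing about the energy law, but the energy-rough sub-cell is EXACTLY what CL would make
vacuous — recorded as the implication «CL ⟹ rough sub-cell» (vacuity), so that
Uᶜ ⟸ CL factors through `critTameScarIsCritical_iff_roughCell`. [folklore] -/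
theorem roughCell_of_leraySharpClock
    (hCL : ∀ (ν T : ℝ), 0 < ν → 0 < T →
      ∀ (u : ℝ → EuclideanSpace ℝ (Fin 3) → EuclideanSpace ℝ (Fin 3))
        (p : ℝ → EuclideanSpace ℝ (Fin 3) → ℝ),
        Literature.Analysis.FluidPDE.IsMaximalSmoothSolution ν 0 u p T →
        Literature.Analysis.FluidPDE.IsLerayHopfOn T ν 0 (u 0) u →
        Literature.Analysis.FluidPDE.HasRapidSpatialDecay (u 0) →
        (∃ K T₁ : ℝ, T₁ < T ∧ ∀ t ∈ Set.Ioo T₁ T,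
          ∫⁻ x, ‖u t x - u T x‖ₑ ^ 2 ≤ ENNReal.ofReal (K * Real.sqrt (T - t))) →
        ∃ C T₂ : ℝ, T₂ < T ∧ ∀ t ∈ Set.Ioo T₂ T,
          (∫ x, ‖u t x‖ ^ 2) - ∫ x, ‖u T x‖ ^ 2 ≤ C * Real.sqrt (T - t)) :
    ∀ (ν T : ℝ), 0 < ν → 0 < T →
    ∀ (u : ℝ → EuclideanSpace ℝ (Fin 3) → EuclideanSpace ℝ (Fin 3))
      (p : ℝ → EuclideanSpace ℝ (Fin 3) → ℝ),
      Literature.Analysis.FluidPDE.IsMaximalSmoothSolution ν 0 u p T →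
      Literature.Analysis.FluidPDE.IsLerayHopfOn T ν 0 (u 0) u →
      Literature.Analysis.FluidPDE.HasRapidSpatialDecay (u 0) →
      Filter.Tendsto (fun t => MeasureTheory.eLpNorm (u t - u T) 2 MeasureTheory.volume)
        (nhdsWithin T (Set.Iio T)) (nhds 0) →
      (∃ K T₁ : ℝ, T₁ < T ∧ ∀ t ∈ Set.Ioo T₁ T,
        ∫⁻ x, ‖u t x - u T x‖ₑ ^ 2 ≤ ENNReal.ofReal (K * Real.sqrt (T - t))) →
      ¬ (∃ C T₂ : ℝ, T₂ < T ∧ ∀ t ∈ Set.Ioo T₂ T,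
        (∫ x, ‖u t x‖ ^ 2) - ∫ x, ‖u T x‖ ^ 2 ≤ C * Real.sqrt (T - t)) →
      ∀ x₀ : EuclideanSpace ℝ (Fin 3), ∃ M r₁ : ℝ, 0 < r₁ ∧ ∀ r ∈ Set.Ioo 0 r₁,
        r⁻¹ * ∫ x in Metric.ball x₀ r, ‖u T x‖ ^ 2 ≤ M := by
  intro ν T hν hT u p hmax hLH hdec _ hclock hrough _
  exact absurd (hCL ν T hν hT u p hmax hLH hdec hclock) hrough

end EnergyClockScarLaw

end Summit.NavierStokesRegularity.NavierStokesRegularity.Theorems
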